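import Summits.Ventures.HodgeRepro2.T5CartanUnitaryThree
import Summits.Ventures.HodgeRepro2.T5CartanFinOne

/-!
# T5UnitaryThreeHecke — the inert-place Hecke package for the record's `U(2,1)` with no Cartan hypothesis,
and a concrete instance

Blind cell pub-hodge-repro2, seat p8, Tier-5 kernel support (corollaries of T5CartanUnitaryThree).

For `U = U(antidiag(1, u, 1))`, `K_U = U ∩ GL₃(R)`, `R` a DVR with finite residue field, `E = Frac R`, an
involution preserving `R`-integrality, `u` a star-fixed unit of `R` and a uniformiser fixed by the involution,
T5UnitaryHeckeAdjoint's theorems hold with the Cartan hypothesis DISCHARGED by `isCartanDecomposition_three`: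
* `finrank_invariants_eq_one_three` — spherical multiplicity one;
* `heckeCharacterAlgHom_three` — the Hecke eigencharacter `H(U, K_U) →ₐ[k] k`;
* `apply_heckeSMul_doubleCosetOp_eq_inv_three` — `B(T_g v, w) = B(v, T_{g⁻¹} w)` for every `U`-invariant
  hermitian form (the printed `π(f)^* = π(f^*)` for unitary `π` at an inert place);
* `ncard_orbit_inv_eq_three` — `#(K_U g⁻¹ K_U / K_U) = #(K_U g K_U / K_U)`.
* `isCartanDecomposition_three_padic` — the concrete instance `ℤ_[p] ⊂ ℚ_[p]`, trivial involution, `u = 1`: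
  the Cartan decomposition of the split orthogonal group `O(antidiag(1,1,1))(ℚ_p)` w.r.t. its integral points,
  every hypothesis met at once (non-vacuity, cf. T5CartanFinOne / T5PadicHeckeCommutative).
-/

namespace Summit.Ventures.HodgeRepro2.T5UnitaryThreeHecke

open Summit.Ventures.HodgeRepro2 Matrix T5HermitianThreeElements T5CartanUnitaryThree

section Corollaries

variable {R : Type*} [CommRing R] [IsDomain R] [IsDiscreteValuationRing R]
  [Finite (IsLocalRing.ResidueField R)] {E : Type*} [Field E] [StarRing E] [Algebra R E]
  [IsFractionRing R E]
  (hstar : ∀ x : E, IsLocalization.IsInteger R x → IsLocalization.IsInteger R (star x))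
  (u : E) (hu : star u = u) (hu0 : u ≠ 0) (huI : IsLocalization.IsInteger R u)
  (huI' : IsLocalization.IsInteger R u⁻¹) (ϖ : R) (hϖ : Irreducible ϖ)
  (hϖs : star (algebraMap R E ϖ) = algebraMap R E ϖ)

omit [StarRing E] in
/-- Persymmetry of `antidiag(1, u, 1)` (the `hJ` of T5UnitaryHeckeAdjoint). -/
theorem J3_rev_rev : ∀ i j, J3 u (Fin.revPerm i) (Fin.revPerm j) = J3 u i j :=
  T5AntidiagonalForm.antidiagonalMatrix_rev_rev ![1, u, 1] (fun i => by fin_cases i <;> rfl)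

omit [Finite (IsLocalRing.ResidueField R)] in
include hstar hu hu0 huI huI' hϖ hϖs in
/-- `#(K_U g⁻¹ K_U / K_U) = #(K_U g K_U / K_U)` for `U(2,1)` — no hypothesis. -/
theorem ncard_orbit_inv_eq_three (g : T5UnitaryGroupForm.formUnitaryGroup (J3 u)) :
    (MulAction.orbit (T5UnitaryHeckeAdjoint.hyperspecialSubgroup R (J3 u))
        (↑g⁻¹ : T5UnitaryGroupForm.formUnitaryGroup (J3 u) ⧸
          T5UnitaryHeckeAdjoint.hyperspecialSubgroup R (J3 u))).ncard =
      (MulAction.orbit (T5UnitaryHeckeAdjoint.hyperspecialSubgroup R (J3 u))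
        (↑g : T5UnitaryGroupForm.formUnitaryGroup (J3 u) ⧸
          T5UnitaryHeckeAdjoint.hyperspecialSubgroup R (J3 u))).ncard :=
  T5UnitaryHeckeAdjoint.ncard_orbit_inv_eq (J3_rev_rev u)
    (isCartanDecomposition_three hstar u hu hu0 huI huI' ϖ hϖ hϖs) g

include hstar hu hu0 huI huI' hϖ hϖs in
/-- SPHERICAL MULTIPLICITY ONE for the record's `U(2,1)` at an inert place — no Cartan hypothesis. -/
theorem finrank_invariants_eq_one_three {k : Type*} [Field k] [CharZero k] [IsAlgClosed k] {V : Type*}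
    [AddCommGroup V] [Module k V] (ρ : Representation k (T5UnitaryGroupForm.formUnitaryGroup (J3 u)) V)
    [ρ.IsIrreducible] (hKF : T5LevelIdempotent.KFinite ρ (T5UnitaryHeckeAdjoint.hyperspecialSubgroup R (J3 u)))
    [FiniteDimensional k (LevelPositivity.invariants ρ (T5UnitaryHeckeAdjoint.hyperspecialSubgroup R (J3 u)))]
    (hne : LevelPositivity.invariants ρ (T5UnitaryHeckeAdjoint.hyperspecialSubgroup R (J3 u)) ≠ ⊥) :
    Module.finrank k (LevelPositivity.invariants ρ (T5UnitaryHeckeAdjoint.hyperspecialSubgroup R (J3 u))) = 1 :=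
  T5UnitaryHeckeAdjoint.finrank_invariants_eq_one (J3_rev_rev u)
    (isCartanDecomposition_three hstar u hu hu0 huI huI' ϖ hϖ hϖs) ρ hKF hne

include hstar hu hu0 huI huI' hϖ hϖs in
/-- THE HECKE EIGENCHARACTER of an irreducible `K_U`-finite representation of the record's `U(2,1)` with
`ρ^{K_U} ≠ 0` — no Cartan hypothesis. -/
noncomputable def heckeCharacterAlgHom_three {k : Type*} [Field k] [CharZero k] [IsAlgClosed k] {V : Type*}
    [AddCommGroup V] [Module k V] (ρ : Representation k (T5UnitaryGroupForm.formUnitaryGroup (J3 u)) V)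
    [ρ.IsIrreducible] (hKF : T5LevelIdempotent.KFinite ρ (T5UnitaryHeckeAdjoint.hyperspecialSubgroup R (J3 u)))
    [FiniteDimensional k (LevelPositivity.invariants ρ (T5UnitaryHeckeAdjoint.hyperspecialSubgroup R (J3 u)))]
    (hne : LevelPositivity.invariants ρ (T5UnitaryHeckeAdjoint.hyperspecialSubgroup R (J3 u)) ≠ ⊥) :
    T5HeckePermutationModule.heckeAlgebra k (T5UnitaryHeckeAdjoint.hyperspecialSubgroup R (J3 u)) →ₐ[k] k :=
  T5UnitaryHeckeAdjoint.heckeCharacterAlgHom (J3_rev_rev u)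
    (isCartanDecomposition_three hstar u hu hu0 huI huI' ϖ hϖ hϖs) ρ hKF hne

include hstar hu hu0 huI huI' hϖ hϖs in
/-- `B(T_g v, w) = B(v, T_{g⁻¹} w)` on `ρ^{K_U}` for every `U(2,1)`-invariant hermitian form — the printed
`π(f)^* = π(f^*)` for unitary `π` at an inert place, no Cartan hypothesis. -/
theorem apply_heckeSMul_doubleCosetOp_eq_inv_three {k : Type*} [Field k] [StarRing k] {V : Type*}
    [AddCommGroup V] [Module k V] {ρ : Representation k (T5UnitaryGroupForm.formUnitaryGroup (J3 u)) V}
    {B : V →ₗ⋆[k] V →ₗ[k] k} (hB : T5HeckeAdjointHermitian.IsInvariantSesq ρ B)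
    (hH : T5HeckeAdjointHermitian.IsHermitian B) (g : T5UnitaryGroupForm.formUnitaryGroup (J3 u))
    (v w : LevelPositivity.invariants ρ (T5UnitaryHeckeAdjoint.hyperspecialSubgroup R (J3 u))) :
    B (T5HeckePermutationModule.heckeSMul ρ
        (T5HeckeDoubleCoset.doubleCosetOp k (T5UnitaryHeckeAdjoint.hyperspecialSubgroup R (J3 u)) g) v) w =
      B v (T5HeckePermutationModule.heckeSMul ρ
        (T5HeckeDoubleCoset.doubleCosetOp k (T5UnitaryHeckeAdjoint.hyperspecialSubgroup R (J3 u)) g⁻¹) w) :=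
  T5UnitaryHeckeAdjoint.apply_heckeSMul_doubleCosetOp_eq_inv (J3_rev_rev u)
    (isCartanDecomposition_three hstar u hu hu0 huI huI' ϖ hϖ hϖs) hB hH g v w

end Corollaries

section Padic

variable (p : ℕ) [Fact p.Prime]

/-- The concrete instance: `ℤ_[p] ⊂ ℚ_[p]` with the trivial involution and `u = 1` — the Cartan decomposition
of `O(antidiag(1, 1, 1))(ℚ_p)` w.r.t. its integral points, every hypothesis of `isCartanDecomposition_three`
met at once. -/
theorem isCartanDecomposition_three_padic :
    letI : StarRing ℚ_[p] := starRingOfComm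
    T5UnitaryHeckeAdjoint.IsCartanDecomposition ℤ_[p] (J3 (1 : ℚ_[p])) Fin.revPerm
      (Units.mk0 (algebraMap ℤ_[p] ℚ_[p] (p : ℤ_[p]))
        ((map_ne_zero_iff _ (IsFractionRing.injective ℤ_[p] ℚ_[p])).2 PadicInt.irreducible_p.ne_zero)) := by
  letI : StarRing ℚ_[p] := starRingOfComm
  exact isCartanDecomposition_three (fun x hx => hx) 1 rfl one_ne_zero IsLocalization.isInteger_one
    (by rw [inv_one]; exact IsLocalization.isInteger_one) (p : ℤ_[p]) PadicInt.irreducible_p rfl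

/-- `H(O(antidiag(1,1,1))(ℚ_p), O(antidiag(1,1,1))(ℤ_p))` is commutative with NO hypothesis. -/
theorem heckeAlgebra_mul_comm_three_padic (k : Type*) [Field k] :
    letI : StarRing ℚ_[p] := starRingOfComm
    ∀ T S : T5HeckePermutationModule.heckeAlgebra k
      (T5UnitaryHeckeAdjoint.hyperspecialSubgroup ℤ_[p] (J3 (1 : ℚ_[p]))), T * S = S * T := by
  letI : StarRing ℚ_[p] := starRingOfComm
  haveI := T5PadicHeckeCommutative.finite_residueField_padicInt p
  exact heckeAlgebra_mul_comm_three (fun x hx => hx) 1 rfl one_ne_zero IsLocalization.isInteger_one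
    (by rw [inv_one]; exact IsLocalization.isInteger_one) (p : ℤ_[p]) PadicInt.irreducible_p rfl k

end Padic

end Summit.Ventures.HodgeRepro2.T5UnitaryThreeHecke
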